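import Mathlib.Analysis.Complex.ReImTopology
import Mathlib.Topology.Order.OrderClosed
import Literature.Topology.PlaneTopology.Rectangles
import HarnessLib

/-!
# Osgood arcs I: ternary gluing of curve pieces

Topic: Topology / PlaneTopology. Elementary bookkeeping for the construction of an **Osgood arc**
(a Jordan arc of positive planar Lebesgue measure, W. F. Osgood, *A Jordan curve of positive
area*, Trans. AMS 4 (1903) 107–112), files `OsgoodArcGlue`, `OsgoodArcCells`, `OsgoodArc`.

This file is curve-piece combinatorics only, no cells and no measure theory:

* `OsgoodArc.glue f g p q` — the curve `[0, 1] → ℂ` that runs `f` at triple speed on `[0, 1/3]`,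
  the affine segment `seg p q` (from `Rectangles.lean`) on `[1/3, 2/3]`, and `g` at triple speed
  on `[2/3, 1]`;
* continuity (`continuous_glue`), range control (`glue_mem`), the sup-distance estimate
  `dist_glue_glue_le`, and the **separation lemma** `glue_sep`: if the outer pieces live in
  disjoint sets avoided by the open bridge, the glued curve identifies only parameters that one
  of the pieces identifies, at one third of the scale (`δ ↦ δ / 3`; `δ = 0` is injectivity);
* closed coordinate boxes `Icc a b ×ℂ Icc c d`: convexity along segments, a diameter bound.

All folklore; everything proved. Mathlib anchors: `Continuous.if_le`, `Set.reProdIm`.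
-/

noncomputable section

open Set Filter

namespace Literature.Topology.PlaneTopology

namespace OsgoodArc

/-! ### Segments and boxes -/

/-- Real part along a segment. [folklore] -/
theorem seg_re (p q : ℂ) (t : ℝ) : (seg p q t).re = p.re + t * (q.re - p.re) :=
  (seg_re_im p q t).1

/-- Imaginary part along a segment. [folklore] -/
theorem seg_im (p q : ℂ) (t : ℝ) : (seg p q t).im = p.im + t * (q.im - p.im) :=
  (seg_re_im p q t).2

/-- Membership in a closed coordinate box, spelled out. [folklore] -/
theorem mem_box {a b c d : ℝ} {z : ℂ} :
    z ∈ Icc a b ×ℂ Icc c d ↔ (a ≤ z.re ∧ z.re ≤ b) ∧ (c ≤ z.im ∧ z.im ≤ d) := Iff.rfl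

/-- Closed coordinate boxes are closed. [folklore] -/
theorem isClosed_box (a b c d : ℝ) : IsClosed (Icc a b ×ℂ Icc c d) :=
  isClosed_Icc.reProdIm isClosed_Icc

/-- Boxes are convex: the segment between two points of a box stays in the box. [folklore] -/
theorem seg_mem_box {a b c d : ℝ} {p q : ℂ} (hp : p ∈ Icc a b ×ℂ Icc c d)
    (hq : q ∈ Icc a b ×ℂ Icc c d) {t : ℝ} (ht : t ∈ Icc (0 : ℝ) 1) :
    seg p q t ∈ Icc a b ×ℂ Icc c d := by
  rw [mem_box] at hp hq ⊢
  rw [seg_re, seg_im]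
  obtain ⟨ht0, ht1⟩ := ht
  refine ⟨⟨?_, ?_⟩, ?_, ?_⟩ <;> nlinarith [hp.1.1, hp.1.2, hp.2.1, hp.2.2, hq.1.1, hq.1.2,
    hq.2.1, hq.2.2]

/-- Two points of a box are at distance at most width plus height. [folklore] -/
theorem dist_le_of_mem_box {a b c d : ℝ} {z w : ℂ} (hz : z ∈ Icc a b ×ℂ Icc c d)
    (hw : w ∈ Icc a b ×ℂ Icc c d) : dist z w ≤ (b - a) + (d - c) := by
  rw [mem_box] at hz hw
  rw [dist_eq_norm]
  refine (Complex.norm_le_abs_re_add_abs_im _).trans ?_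
  rw [Complex.sub_re, Complex.sub_im]
  have h1 : |z.re - w.re| ≤ b - a := abs_sub_le_iff.2 ⟨by linarith [hz.1.2, hw.1.1],
    by linarith [hz.1.1, hw.1.2]⟩
  have h2 : |z.im - w.im| ≤ d - c := abs_sub_le_iff.2 ⟨by linarith [hz.2.2, hw.2.1],
    by linarith [hz.2.1, hw.2.2]⟩
  linarith

/-! ### Ternary gluing -/

/-- **Ternary gluing**: run `f` at triple speed on `[0, 1/3]`, then the straight segment from `p`
to `q` on `[1/3, 2/3]`, then `g` at triple speed on `[2/3, 1]`. [folklore] -/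
def glue (f g : ℝ → ℂ) (p q : ℂ) (t : ℝ) : ℂ :=
  if t ≤ 1 / 3 then f (3 * t) else if t ≤ 2 / 3 then seg p q (3 * t - 1) else g (3 * t - 2)

section glue

variable {f g : ℝ → ℂ} {p q : ℂ}

/-- On `[0, 1/3]` the glued curve is the first piece. [folklore] -/
theorem glue_of_le_third (f g : ℝ → ℂ) (p q : ℂ) {t : ℝ} (ht : t ≤ 1 / 3) :
    glue f g p q t = f (3 * t) := by
  rw [glue, if_pos ht]

/-- On `(1/3, 2/3]` the glued curve is the bridge. [folklore] -/
theorem glue_of_mem_mid (f g : ℝ → ℂ) (p q : ℂ) {t : ℝ} (h1 : 1 / 3 < t) (h2 : t ≤ 2 / 3) :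
    glue f g p q t = seg p q (3 * t - 1) := by
  rw [glue, if_neg (not_le.2 h1), if_pos h2]

/-- On `(2/3, 1]` the glued curve is the third piece. [folklore] -/
theorem glue_of_gt (f g : ℝ → ℂ) (p q : ℂ) {t : ℝ} (h : 2 / 3 < t) :
    glue f g p q t = g (3 * t - 2) := by
  have h' : ¬ t ≤ 1 / 3 := not_le.2 (by linarith)
  rw [glue, if_neg h', if_neg (not_le.2 h)]

/-- On `[2/3, 1]` the glued curve is the third piece, provided it starts at `q`. [folklore] -/
theorem glue_of_ge (f : ℝ → ℂ) {g : ℝ → ℂ} (p : ℂ) {q : ℂ} (hg : g 0 = q) {t : ℝ}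
    (h : 2 / 3 ≤ t) : glue f g p q t = g (3 * t - 2) := by
  rcases h.lt_or_eq with h | rfl
  · exact glue_of_gt f g p q h
  · rw [glue_of_mem_mid f g p q (by norm_num) le_rfl]
    norm_num [hg]

/-- The glued curve starts where the first piece starts. [folklore] -/
@[simp] theorem glue_zero (f g : ℝ → ℂ) (p q : ℂ) : glue f g p q 0 = f 0 := by
  rw [glue_of_le_third f g p q (by norm_num), mul_zero]

/-- The glued curve ends where the third piece ends. [folklore] -/
@[simp] theorem glue_one (f g : ℝ → ℂ) (p q : ℂ) : glue f g p q 1 = g 1 := by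
  rw [glue_of_gt f g p q (by norm_num)]; norm_num

/-- The first piece, read off at time `t / 3`. [folklore] -/
theorem glue_div_three (f g : ℝ → ℂ) (p q : ℂ) {t : ℝ} (ht : t ∈ Icc (0 : ℝ) 1) :
    glue f g p q (t / 3) = f t := by
  rw [glue_of_le_third f g p q (by linarith [ht.2])]
  congr 1; ring

/-- The third piece, read off at time `(t + 2) / 3`. [folklore] -/
theorem glue_add_two_div_three (f : ℝ → ℂ) {g : ℝ → ℂ} (p : ℂ) {q : ℂ} (hg : g 0 = q) {t : ℝ}
    (ht : t ∈ Icc (0 : ℝ) 1) : glue f g p q ((t + 2) / 3) = g t := by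
  rw [glue_of_ge f p hg (by linarith [ht.1])]
  congr 1; ring

/-- The glued curve is continuous when the pieces match at the joints. [folklore] -/
theorem continuous_glue (hf : Continuous f) (hg : Continuous g) (hf1 : f 1 = p) (hg0 : g 0 = q) :
    Continuous (glue f g p q) := by
  unfold glue
  refine Continuous.if_le (hf.comp (by fun_prop)) ?_ continuous_id continuous_const ?_
  · refine Continuous.if_le ((continuous_seg p q).comp (by fun_prop)) (hg.comp (by fun_prop))
      continuous_id continuous_const ?_
    rintro x rfl
    norm_num [hg0]
  · rintro x rfl
    norm_num [hf1]

/-- The glued curve stays in any set containing the two pieces and the bridge. [folklore] -/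
theorem glue_mem {S : Set ℂ} (hf : ∀ t ∈ Icc (0 : ℝ) 1, f t ∈ S)
    (hg : ∀ t ∈ Icc (0 : ℝ) 1, g t ∈ S) (hs : ∀ t ∈ Icc (0 : ℝ) 1, seg p q t ∈ S) {t : ℝ}
    (ht : t ∈ Icc (0 : ℝ) 1) : glue f g p q t ∈ S := by
  obtain ⟨ht0, ht1⟩ := ht
  unfold glue
  split_ifs with h1 h2
  · exact hf _ ⟨by linarith, by linarith⟩
  · exact hs _ ⟨by linarith [not_le.1 h1], by linarith⟩
  · exact hg _ ⟨by linarith [not_le.1 h2], by linarith⟩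

/-- Gluing (with a common bridge) is `1`-Lipschitz for the sup distance on `[0, 1]`.
[folklore] -/
theorem dist_glue_glue_le {f' g' : ℝ → ℂ} {δ : ℝ} (hδ : 0 ≤ δ)
    (hf : ∀ t ∈ Icc (0 : ℝ) 1, dist (f t) (f' t) ≤ δ)
    (hg : ∀ t ∈ Icc (0 : ℝ) 1, dist (g t) (g' t) ≤ δ) {t : ℝ} (ht : t ∈ Icc (0 : ℝ) 1) :
    dist (glue f g p q t) (glue f' g' p q t) ≤ δ := by
  obtain ⟨ht0, ht1⟩ := ht
  unfold glue
  split_ifs with h1 h2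
  · exact hf _ ⟨by linarith, by linarith⟩
  · simpa using hδ
  · exact hg _ ⟨by linarith [not_le.1 h2], by linarith⟩

/-- The three ternary regimes of a time parameter. [folklore] -/
theorem trichotomy_thirds (t : ℝ) : t ≤ 1 / 3 ∨ (1 / 3 < t ∧ t < 2 / 3) ∨ 2 / 3 ≤ t := by
  rcases le_or_gt t (1 / 3) with h | h
  · exact Or.inl h
  · rcases lt_or_ge t (2 / 3) with h' | h'
    · exact Or.inr (Or.inl ⟨h, h'⟩)
    · exact Or.inr (Or.inr h')

/-- **Separation lemma for glued curves.** If the two outer pieces take values in disjoint sets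
`A`, `B`, the open bridge avoids `A` and `B`, the bridge is non-degenerate, and each outer piece
identifies only parameters at distance `≤ δ`, then the glued curve identifies only parameters at
distance `≤ δ / 3`. (With `δ = 0` this is injectivity of the glued curve.) [folklore] -/
theorem glue_sep {A B : Set ℂ} {δ : ℝ} (hδ : 0 ≤ δ)
    (hfA : ∀ t ∈ Icc (0 : ℝ) 1, f t ∈ A) (hgB : ∀ t ∈ Icc (0 : ℝ) 1, g t ∈ B)
    (hAB : Disjoint A B) (hpq : p ≠ q)
    (hbr : ∀ u ∈ Ioo (0 : ℝ) 1, seg p q u ∉ A ∧ seg p q u ∉ B) (hg0 : g 0 = q)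
    (hf : ∀ s ∈ Icc (0 : ℝ) 1, ∀ t ∈ Icc (0 : ℝ) 1, f s = f t → |s - t| ≤ δ)
    (hg : ∀ s ∈ Icc (0 : ℝ) 1, ∀ t ∈ Icc (0 : ℝ) 1, g s = g t → |s - t| ≤ δ)
    {s : ℝ} (hs : s ∈ Icc (0 : ℝ) 1) {t : ℝ} (ht : t ∈ Icc (0 : ℝ) 1)
    (hst : glue f g p q s = glue f g p q t) : |s - t| ≤ δ / 3 := by
  obtain ⟨hs0, hs1⟩ := hs
  obtain ⟨ht0, ht1⟩ := ht
  -- values and parameter ranges in the three regimes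
  have vL : ∀ {x : ℝ}, 0 ≤ x → x ≤ 1 / 3 →
      glue f g p q x = f (3 * x) ∧ 3 * x ∈ Icc (0 : ℝ) 1 :=
    fun h0 h => ⟨glue_of_le_third f g p q h, ⟨by linarith, by linarith⟩⟩
  have vM : ∀ {x : ℝ}, 1 / 3 < x → x < 2 / 3 →
      glue f g p q x = seg p q (3 * x - 1) ∧ 3 * x - 1 ∈ Ioo (0 : ℝ) 1 :=
    fun h1 h2 => ⟨glue_of_mem_mid f g p q h1 h2.le, ⟨by linarith, by linarith⟩⟩
  have vR : ∀ {x : ℝ}, 2 / 3 ≤ x → x ≤ 1 →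
      glue f g p q x = g (3 * x - 2) ∧ 3 * x - 2 ∈ Icc (0 : ℝ) 1 :=
    fun h h1 => ⟨glue_of_ge f p hg0 h, ⟨by linarith, by linarith⟩⟩
  have hδ3 : 0 ≤ δ / 3 := by positivity
  rcases trichotomy_thirds s with hS | hS | hS <;> rcases trichotomy_thirds t with hT | hT | hT
  · -- first piece / first piece
    obtain ⟨es, ms⟩ := vL hs0 hS; obtain ⟨et, mt⟩ := vL ht0 hT
    rw [es, et] at hst
    have := hf _ ms _ mt hst
    rw [show 3 * s - 3 * t = 3 * (s - t) by ring, abs_mul,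
      abs_of_pos (by norm_num : (0 : ℝ) < 3)] at this
    linarith
  · -- first piece / bridge
    obtain ⟨es, ms⟩ := vL hs0 hS; obtain ⟨et, mt⟩ := vM hT.1 hT.2
    rw [es, et] at hst
    exact absurd (hst ▸ hfA _ ms) (hbr _ mt).1
  · -- first piece / third piece
    obtain ⟨es, ms⟩ := vL hs0 hS; obtain ⟨et, mt⟩ := vR hT ht1
    rw [es, et] at hst
    exact absurd (hst ▸ hfA _ ms) (hAB.notMem_of_mem_right (hgB _ mt))
  · -- bridge / first piece
    obtain ⟨es, ms⟩ := vM hS.1 hS.2; obtain ⟨et, mt⟩ := vL ht0 hT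
    rw [es, et] at hst
    exact absurd (hst ▸ (hbr _ ms).1) (not_not.2 (hfA _ mt))
  · -- bridge / bridge
    obtain ⟨es, ms⟩ := vM hS.1 hS.2; obtain ⟨et, mt⟩ := vM hT.1 hT.2
    rw [es, et] at hst
    have := injective_seg hpq hst
    have : s = t := by linarith
    rw [this, sub_self, abs_zero]; exact hδ3
  · -- bridge / third piece
    obtain ⟨es, ms⟩ := vM hS.1 hS.2; obtain ⟨et, mt⟩ := vR hT ht1
    rw [es, et] at hst
    exact absurd (hst ▸ (hbr _ ms).2) (not_not.2 (hgB _ mt))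
  · -- third piece / first piece
    obtain ⟨es, ms⟩ := vR hS hs1; obtain ⟨et, mt⟩ := vL ht0 hT
    rw [es, et] at hst
    exact absurd (hst ▸ hgB _ ms) (hAB.notMem_of_mem_left (hfA _ mt))
  · -- third piece / bridge
    obtain ⟨es, ms⟩ := vR hS hs1; obtain ⟨et, mt⟩ := vM hT.1 hT.2
    rw [es, et] at hst
    exact absurd (hst ▸ hgB _ ms) (hbr _ mt).2
  · -- third piece / third piece
    obtain ⟨es, ms⟩ := vR hS hs1; obtain ⟨et, mt⟩ := vR hT ht1
    rw [es, et] at hst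
    have := hg _ ms _ mt hst
    rw [show 3 * s - 2 - (3 * t - 2) = 3 * (s - t) by ring, abs_mul,
      abs_of_pos (by norm_num : (0 : ℝ) < 3)] at this
    linarith

end glue

end OsgoodArc

end Literature.Topology.PlaneTopology
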